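import Summits.HubbardSuperconductivity.HubbardSuperconductivity.Theorems.KLProgrammeKLRegimeScaleZeroCovarianceTorusPeriodisation
import Summits.HubbardSuperconductivity.HubbardSuperconductivity.Theorems.KLProgrammeKLRegimeScaleZeroMatsubaraWindowAbel

/-!
# Route `KLProgramme`, crux K3 — engine-flow child (stmt-HubbardSuperconductivity-20437), stub (C) at `n = 0`, located gap «(2e)-FAR-SITES» (pen (R196)),
# the p1 pieces (F-c)+(F-d) of the TIME-PARSEVAL route (k3c5-p1 FAR-SITES-NOTE-g14 §4): per-frequency decay of the torus factor from a CERTIFIED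
# momentum-jet ENVELOPE, and the β-UNIFORM sum of its squares over the Matsubara window

Cell gate-hubbard-kl, seat p1 g21.  The far-site rows of #22a are read through (F-a) Gram × (F-b) time Parseval on the grid (`Σ_{j₁}‖A₁(z;j₁,j₀)‖² =
4M·Σ_i‖c_i(z)‖²`, `c_i(z) = (1/β)e^{iω_iΔτ}H_z(ω_i)`, `H_z(ω) = L⁻²Σ_k χ_k(z̄)Ψ¹(ω, e_K(2πk/L))`) × (F-c) spatial decay per frequency from jets × (F-d) the
β-uniform frequency sum.  Here (F-c)+(F-d), with the jets supplied as ONE certified envelope (the FAR-CERT currency of the note):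
`∀ ω ≠ 0, ∀ y, ‖Dᵐ_y g_ω(y)‖ ≤ Jm / max(|ω|, Λ/2)`, `g_ω(y) = uvSymbolFn 1 Λ (frameLevel μ K (2π•y)) ω` on `Momentum` (p1 g19's jet currency verbatim):

* **`norm_torusFactor_le_of_envelope`** — `‖H_z(ω)‖ ≤ (Jm/max(|ω|,Λ/2))/π^m · (1 + 4ᵐS_m) · (1+‖z‖_∞)^{−m}` for centred off-site `z` (`2‖z‖ ≤ L`, `z̄ ≠ 0`), `m ≥ 4`
  (= `norm_torusFourierInv_uvSpatialSample_le_inv_pow_offSite` with `D := Jm/m(ω)`);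
* **`sum_matsubaraIdx_norm_sq_torusFactor_le_of_envelope`** — `Σ_{i : MatsubaraIdx M} ‖H_z(ω_i)‖² ≤ β·(2/Λ)·(Jm(1+4ᵐS_m)/π^m)²·(1+‖z‖_∞)^{−2m}`, uniformly in
  `M` and `β > 0` (`sum_matsubaraIdx_one_div_max_sq_le`); with `c_i = (1/β)·phase·H_z(ω_i)` this is `Σ_i‖c_i‖² ≤ (1/β)·(2/Λ)·(…)²·(1+‖z‖)^{−2m}` — the `1/β` of the
  row currency, no time decay, no profiles, no tails.

Proofs only; no definitions; nothing here asserts (C), any stub of 20437, K3 or superconductivity; `Jm` is an INPUT (to be certified kit-side under a named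
hypothesis — never «proved»).  References: BGM 2006 §2.1–§2.2 (2.3)–(2.4) [cite: BenfattoGiulianiMastropietro2006].
-/

noncomputable section

namespace Summit.HubbardSuperconductivity.HubbardSuperconductivity.Theorems.KLRegimeSplit

set_option linter.dupNamespace false -- summit = problem name (single-conjunct summit), D-0017

open Literature.MathematicalPhysics.QuantumLattice Literature.Probability.LatticeModels Literature.Analysis.FunctionSpaces
open Summit.HubbardSuperconductivity.HubbardSuperconductivity.Theorems.DispersionFlow
open Finset Real

variable {L : ℕ} [NeZero L]

/-- **(F-c) Per-frequency decay from a certified envelope**: if `‖Dᵐ g_ω‖ ≤ Jm/max(|ω|,Λ/2)` on `Momentum` (`ω ≠ 0`), then for a centred off-site `z`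
(`2‖z‖_∞ ≤ L`, `z̄ ≠ 0`) and `m ≥ 4`: `‖L⁻²Σ_k χ_k(z̄)Ψ¹(ω,e_K(k))‖ ≤ (Jm/max(|ω|,Λ/2))/π^m·(1+4ᵐS_m)·(1+‖z‖_∞)^{−m}`. -/
theorem norm_torusFactor_le_of_envelope {Λ : ℝ} (μ : ℝ) (K : TrigPolyC4v) {m : ℕ} (hm : 2 * 2 ≤ m) {Jm : ℝ} {om : ℝ} (hom : om ≠ 0)
    (hJ : ∀ y : Momentum, ‖iteratedFDeriv ℝ m (fun y : Momentum => uvSymbolFn 1 Λ (frameLevel μ K ((2 * π) • y)) om) y‖ ≤ Jm / max |om| (Λ / 2))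
    {z : Site 2} (hz : 2 * ‖z‖ ≤ L) (hz0 : Torus.proj L z ≠ 0) :
    ‖torusFourierInv (fun kv : TorusSite 2 L =>
        (fun y : Momentum => uvSymbolFn 1 Λ (frameLevel μ K ((2 * π) • y)) om) (WithLp.toLp 2 fun i => ((kv i).val : ℝ) / L)) (Torus.proj L z)‖ ≤
      (Jm / max |om| (Λ / 2) / Real.pi ^ m) * (1 + (4 : ℝ) ^ m * ∑' n : Site 2, ((1 + ‖n‖) ^ m)⁻¹) * ((1 + ‖z‖) ^ m)⁻¹ :=
  norm_torusFourierInv_uvSpatialSample_le_inv_pow_offSite 1 μ K hom hm hJ hz hz0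

/-- **(F-d) The β-uniform sum of squares over the window**: with the envelope for every `ω ≠ 0` (`0 ≤ Jm`, `0 < Λ`, `0 < β`), for a centred off-site `z` and `m ≥ 4`:
`Σ_{i : MatsubaraIdx M} ‖H_z(ω_i)‖² ≤ β·(2/Λ)·(Jm·(1+4ᵐS_m)/π^m)²·((1+‖z‖_∞)^m)⁻²` — uniformly in `M`; the Matsubara frequencies are nonzero. -/
theorem sum_matsubaraIdx_norm_sq_torusFactor_le_of_envelope {β : ℝ} (hβ : 0 < β) (M : ℕ) {Λ : ℝ} (hΛ : 0 < Λ) (μ : ℝ) (K : TrigPolyC4v) {m : ℕ}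
    (hm : 2 * 2 ≤ m) {Jm : ℝ} (hJm : 0 ≤ Jm)
    (hJ : ∀ om : ℝ, om ≠ 0 → ∀ y : Momentum,
      ‖iteratedFDeriv ℝ m (fun y : Momentum => uvSymbolFn 1 Λ (frameLevel μ K ((2 * π) • y)) om) y‖ ≤ Jm / max |om| (Λ / 2))
    {z : Site 2} (hz : 2 * ‖z‖ ≤ L) (hz0 : Torus.proj L z ≠ 0) :
    ∑ i : MatsubaraIdx M, ‖torusFourierInv (fun kv : TorusSite 2 L =>
        (fun y : Momentum => uvSymbolFn 1 Λ (frameLevel μ K ((2 * π) • y)) (matsubaraFreq β M i)) (WithLp.toLp 2 fun i => ((kv i).val : ℝ) / L))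
        (Torus.proj L z)‖ ^ 2 ≤
      β * (2 / Λ) * (Jm * (1 + (4 : ℝ) ^ m * ∑' n : Site 2, ((1 + ‖n‖) ^ m)⁻¹) / Real.pi ^ m) ^ 2 * (((1 + ‖z‖) ^ m)⁻¹) ^ 2 := by
  have hS0 : 0 ≤ ∑' n : Site 2, ((1 + ‖n‖) ^ m)⁻¹ := tsum_nonneg fun _ => by positivity
  set A : ℝ := Jm * (1 + (4 : ℝ) ^ m * ∑' n : Site 2, ((1 + ‖n‖) ^ m)⁻¹) / Real.pi ^ m * ((1 + ‖z‖) ^ m)⁻¹ with hA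
  have hA0 : 0 ≤ A := by positivity
  -- per frequency: `‖H_z(ω_i)‖ ≤ A / max(|ω_i|, Λ/2)`
  have hpt : ∀ i : MatsubaraIdx M, ‖torusFourierInv (fun kv : TorusSite 2 L =>
      (fun y : Momentum => uvSymbolFn 1 Λ (frameLevel μ K ((2 * π) • y)) (matsubaraFreq β M i)) (WithLp.toLp 2 fun i => ((kv i).val : ℝ) / L))
      (Torus.proj L z)‖ ≤ A / max |matsubaraFreq β M i| (Λ / 2) := by
    intro i
    have hne : matsubaraFreq β M i ≠ 0 := matsubaraFreq_ne_zero hβ.ne' i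
    have h := norm_torusFactor_le_of_envelope (L := L) μ K hm hne (hJ _ hne) hz hz0
    refine h.trans (le_of_eq ?_)
    have hm0 : 0 < max |matsubaraFreq β M i| (Λ / 2) := lt_max_of_lt_right (by positivity)
    rw [hA]
    field_simp
  have hsq : ∀ i : MatsubaraIdx M, ‖torusFourierInv (fun kv : TorusSite 2 L =>
      (fun y : Momentum => uvSymbolFn 1 Λ (frameLevel μ K ((2 * π) • y)) (matsubaraFreq β M i)) (WithLp.toLp 2 fun i => ((kv i).val : ℝ) / L))
      (Torus.proj L z)‖ ^ 2 ≤ A ^ 2 * (1 / max |matsubaraFreq β M i| (Λ / 2) ^ 2) := by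
    intro i
    have h := pow_le_pow_left₀ (norm_nonneg _) (hpt i) 2
    refine h.trans (le_of_eq ?_)
    rw [div_pow]; ring
  calc ∑ i : MatsubaraIdx M, ‖torusFourierInv (fun kv : TorusSite 2 L =>
        (fun y : Momentum => uvSymbolFn 1 Λ (frameLevel μ K ((2 * π) • y)) (matsubaraFreq β M i)) (WithLp.toLp 2 fun i => ((kv i).val : ℝ) / L))
        (Torus.proj L z)‖ ^ 2
      ≤ ∑ i : MatsubaraIdx M, A ^ 2 * (1 / max |matsubaraFreq β M i| (Λ / 2) ^ 2) := Finset.sum_le_sum fun i _ => hsq i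
    _ = A ^ 2 * ∑ i : MatsubaraIdx M, 1 / max |matsubaraFreq β M i| (Λ / 2) ^ 2 := by rw [Finset.mul_sum]
    _ ≤ A ^ 2 * (β * (2 / Λ)) := mul_le_mul_of_nonneg_left (sum_matsubaraIdx_one_div_max_sq_le hβ hΛ M) (by positivity)
    _ = β * (2 / Λ) * (Jm * (1 + (4 : ℝ) ^ m * ∑' n : Site 2, ((1 + ‖n‖) ^ m)⁻¹) / Real.pi ^ m) ^ 2 * (((1 + ‖z‖) ^ m)⁻¹) ^ 2 := by
        rw [hA]; ring

end Summit.HubbardSuperconductivity.HubbardSuperconductivity.Theorems.KLRegimeSplit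

end
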